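import Summits.FinalStateConjecture.FinalStateConjecture.Theorems.EIHFluxBalanceInertialRecessionStubEndgameOraclePairRound
import Summits.FinalStateConjecture.FinalStateConjecture.Theorems.EIHFluxBalanceInertialRecessionStubEndgameOracleBandsPrep

/-!
# Route EIHFluxBalance — crux `InertialRecession`, line `sublinear-is-free-clean-window-charges`:
# the increment oracle for a slow PAIR with ballistic outsiders — spread phase + compact rounds (`pair_slow_increment`)

Helper file for the crux `stmt-FinalStateConjecture-10166`
(`Summit.FinalStateConjecture.FinalStateConjecture.Theses.EIHFluxBalance.InertialRecession`), registered stub `stub_incrementOracle`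
(lead reshape r9/r10) of `Cruxes/InertialRecession/Lines/sublinear_is_free_clean_window_charges.lean`; lead's roadmap §9 (`|S| = 2`).

`pair_slow_increment`: the `|S| = 2` case of the increment ORACLE (any number `N − 2` of ballistic outsiders). Up to the first time `τ₁`
at which `‖ξₗ − ξₖ‖ ≤ c₀s/4` the pair is SPREAD and two singleton windows with the partner FAR (`λ = c₀/4`) do it (`tight_increment_mixed`);
afterwards `‖ξₗ − ξₖ‖ < c₀s/2` for ever (no up-crossing, `dist_lt_level_of_lt`) and `pair_round` is iterated: the fuel
`#{m : x_m − 3d < 0} ≤ N − 2` drops at every round end before `t₂`. Total: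
`|ΔE|, |ΔΠ^k| ≤ 2X_s + (N − 1)·3X` with the explicit `X_s`, `X` of the statement (all small at late times).
-/

noncomputable section

set_option linter.dupNamespace false

open Filter Topology Set MeasureTheory intervalIntegral
open scoped Topology BigOperators InnerProductSpace RealInnerProductSpace

namespace Summit.FinalStateConjecture.FinalStateConjecture.Theorems.SublinearIsFree.Oracle

open Literature.Geometry.Lorentzian
open Summit.FinalStateConjecture.FinalStateConjecture.Theorems.SublinearIsFree.Endgame

set_option maxHeartbeats 3200000 in
/-- **THE INCREMENT ORACLE FOR A SLOW PAIR WITH BALLISTIC OUTSIDERS.** See the module docstring. [folklore] -/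
theorem pair_slow_increment {N : ℕ} (M : Fin N → ℝ) (ξ v : Fin N → ℝ → E3) (κ : ℝ) (P : ℝ → E3 → ℝ → Fin 4 → ℝ)
    (ρ : ℝ → ℝ) (C T T' T₀ : ℝ) (ζ : ℝ → ℝ)
    (hWL : ∀ (t₁ t₂ : ℝ) (c : ℝ → E3) (R : ℝ → ℝ), T ≤ t₁ → t₁ ≤ t₂ →
      (∀ s ∈ Set.Icc t₁ t₂, ∀ s' ∈ Set.Icc t₁ t₂, ‖c s - c s'‖ ≤ 2 * |s - s'| ∧ |R s - R s'| ≤ 2 * |s - s'|) →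
      (∀ s ∈ Set.Icc t₁ t₂, ρ s ≤ (1 / 2) * R s ∧ ‖c s‖ + R s ≤ (κ + κ ^ 2) / 2 * s ∧
        ∀ j, ‖ξ j s - c s‖ ≤ (1 - 1 / 2) * R s ∨ (1 + 1 / 2) * R s ≤ ‖ξ j s - c s‖) →
      ∀ μ : Fin 4, |P t₂ (c t₂) (R t₂) μ - P t₁ (c t₁) (R t₁) μ| ≤ C * ∫ s in t₁..t₂, (R s ^ (3 / 2 : ℝ))⁻¹)
    (hID : ∀ (t : ℝ) (c : E3) (R : ℝ) (A : Finset (Fin N)), T' ≤ t → ρ t ≤ (1 / 2) * R →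
      ‖c‖ + R ≤ (κ + κ ^ 2) / 2 * t →
      (∀ j, ‖ξ j t - c‖ ≤ (1 - 1 / 2) * R ∨ (1 + 1 / 2) * R ≤ ‖ξ j t - c‖) →
      (∀ j, j ∈ A ↔ ‖ξ j t - c‖ ≤ (1 - 1 / 2) * R) →
      |P t c R 0 - ∑ j ∈ A, M j * (√(1 - ‖v j t‖ ^ 2))⁻¹| ≤ ζ t ∧
      ∀ k : Fin 3, |P t c R k.succ - ∑ j ∈ A, M j * (√(1 - ‖v j t‖ ^ 2))⁻¹ * v j t k| ≤ ζ t)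
    (hC : 0 ≤ C) (hκ0 : 0 < κ) (hκ1 : κ < 1)
    (hξ : ∀ i, ContDiff ℝ 1 (ξ i)) (hspeed1 : ∀ i s, T₀ ≤ s → ‖deriv (ξ i) s‖ ≤ 1)
    {k l : Fin N} (hkl : k ≠ l)
    {t₁ t₂ W A₀ σ ζstar : ℝ} (hT : T ≤ t₁) (hT' : T' ≤ t₁) (hT₀ : T₀ ≤ t₁) (ht₁ : 0 < t₁) (h12 : t₁ ≤ t₂)
    (hW : 0 < W) (hA₀ : 0 < A₀) (hσ0 : 0 ≤ σ) (hσ1 : 78 * σ ≤ W) (hσ2 : 120 * (Finset.univ \ {k, l} : Finset (Fin N)).card * σ ≤ W)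
    (hσ3 : σ ≤ (κ - κ ^ 2) / 2 * (1 / 2))
    (hcone : ∀ i, ∀ s ∈ Set.Icc t₁ t₂, ‖ξ i s‖ ≤ κ ^ 2 * s)
    (n : Fin N → Fin N → E3) (hn : ∀ i ∈ ({k, l} : Finset (Fin N)), ∀ m ∈ Finset.univ \ {k, l}, ‖n i m‖ = 1)
    (hball : ∀ i ∈ ({k, l} : Finset (Fin N)), ∀ m ∈ Finset.univ \ {k, l}, ∀ s ∈ Icc t₁ t₂,
      W / 2 ≤ ⟪deriv (ξ m) s - deriv (ξ i) s, n i m⟫)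
    (hfar : ∀ i j, i ≠ j → ∀ s ∈ Icc t₁ t₂, A₀ ≤ ‖ξ i s - ξ j s‖)
    (hslow : ∀ s ∈ Icc t₁ t₂, ∀ s' ∈ Icc t₁ t₂, s ≤ s' → |‖ξ l s' - ξ k s'‖ - ‖ξ l s - ξ k s‖| ≤ σ * (s' - s))
    (hρ : ∀ s ∈ Set.Icc t₁ t₂, (∀ i j, i ≠ j → ρ s ≤ ‖ξ i s - ξ j s‖ / 3) ∧ ρ s ≤ (κ - κ ^ 2) / 2 * s / 2)
    (hζ : ∀ s ∈ Set.Icc t₁ t₂, ζ s ≤ ζstar) (hζ0 : ∀ s ∈ Set.Icc t₁ t₂, 0 ≤ ζ s) :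
    |∑ j ∈ ({k, l} : Finset (Fin N)), M j * (√(1 - ‖v j t₂‖ ^ 2))⁻¹ - ∑ j ∈ ({k, l} : Finset (Fin N)), M j * (√(1 - ‖v j t₁‖ ^ 2))⁻¹| ≤
        2 * (C * (2 * (((κ - κ ^ 2) / 2) ^ (3 / 2 : ℝ))⁻¹ * (t₁ ^ (1 / 2 : ℝ))⁻¹ +
          (Finset.univ \ {k, l} : Finset (Fin N)).card * (2 * (2 * √2 * (8 / (W * √A₀)))) +
          1 * (2 * (2 * (((κ - κ ^ 2) / 2 / 4) ^ (3 / 2 : ℝ))⁻¹ * (t₁ ^ (1 / 2 : ℝ))⁻¹))) + 2 * ζstar) +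
        ((Finset.univ \ {k, l} : Finset (Fin N)).card + 1) *
          (3 * (C * (2 * (((κ - κ ^ 2) / 2) ^ (3 / 2 : ℝ))⁻¹ * (t₁ ^ (1 / 2 : ℝ))⁻¹ +
            (Finset.univ \ {k, l} : Finset (Fin N)).card * (2 * (2 * √2 * (8 / (W * √A₀)))) +
            2 * (19 * (Finset.univ \ {k, l} : Finset (Fin N)).card / (W * √A₀))) + 2 * ζstar)) ∧
    ∀ kk : Fin 3, |∑ j ∈ ({k, l} : Finset (Fin N)), M j * (√(1 - ‖v j t₂‖ ^ 2))⁻¹ * v j t₂ kk -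
        ∑ j ∈ ({k, l} : Finset (Fin N)), M j * (√(1 - ‖v j t₁‖ ^ 2))⁻¹ * v j t₁ kk| ≤
        2 * (C * (2 * (((κ - κ ^ 2) / 2) ^ (3 / 2 : ℝ))⁻¹ * (t₁ ^ (1 / 2 : ℝ))⁻¹ +
          (Finset.univ \ {k, l} : Finset (Fin N)).card * (2 * (2 * √2 * (8 / (W * √A₀)))) +
          1 * (2 * (2 * (((κ - κ ^ 2) / 2 / 4) ^ (3 / 2 : ℝ))⁻¹ * (t₁ ^ (1 / 2 : ℝ))⁻¹))) + 2 * ζstar) +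
        ((Finset.univ \ {k, l} : Finset (Fin N)).card + 1) *
          (3 * (C * (2 * (((κ - κ ^ 2) / 2) ^ (3 / 2 : ℝ))⁻¹ * (t₁ ^ (1 / 2 : ℝ))⁻¹ +
            (Finset.univ \ {k, l} : Finset (Fin N)).card * (2 * (2 * √2 * (8 / (W * √A₀)))) +
            2 * (19 * (Finset.univ \ {k, l} : Finset (Fin N)).card / (W * √A₀))) + 2 * ζstar)) := by
  classical
  set c₀ : ℝ := (κ - κ ^ 2) / 2 with hc₀def
  have hκκ : 0 < κ - κ ^ 2 := by nlinarith
  have hc₀ : 0 < c₀ := by positivity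
  set O : Finset (Fin N) := Finset.univ \ {k, l} with hOdef
  have hmemO : ∀ m, m ∈ O ↔ m ≠ k ∧ m ≠ l := fun m ↦ by simp [hOdef]
  set Xs : ℝ := C * (2 * (c₀ ^ (3 / 2 : ℝ))⁻¹ * (t₁ ^ (1 / 2 : ℝ))⁻¹ + O.card * (2 * (2 * √2 * (8 / (W * √A₀)))) +
      1 * (2 * (2 * ((c₀ / 4) ^ (3 / 2 : ℝ))⁻¹ * (t₁ ^ (1 / 2 : ℝ))⁻¹))) + 2 * ζstar with hXs
  set Y : ℝ := 3 * (C * (2 * (c₀ ^ (3 / 2 : ℝ))⁻¹ * (t₁ ^ (1 / 2 : ℝ))⁻¹ + O.card * (2 * (2 * √2 * (8 / (W * √A₀)))) +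
      2 * (19 * O.card / (W * √A₀))) + 2 * ζstar) with hY
  set E : ℝ → ℝ := fun s ↦ ∑ j ∈ ({k, l} : Finset (Fin N)), M j * (√(1 - ‖v j s‖ ^ 2))⁻¹ with hE
  set Pk : Fin 3 → ℝ → ℝ := fun kk s ↦ ∑ j ∈ ({k, l} : Finset (Fin N)), M j * (√(1 - ‖v j s‖ ^ 2))⁻¹ * v j s kk with hPk
  have hkmem : k ∈ ({k, l} : Finset (Fin N)) := by simp
  have hlmem : l ∈ ({k, l} : Finset (Fin N)) := by simp
  have hζstar0 : 0 ≤ ζstar := (hζ0 t₁ ⟨le_rfl, h12⟩).trans (hζ t₁ ⟨le_rfl, h12⟩)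
  have hY0 : 0 ≤ Y := by positivity
  have hXs0 : 0 ≤ Xs := by positivity
  ---------------------------------------------------------------- the spread phase `[t₁, τ₁]`
  set SPR : Set ℝ := {s | s ∈ Set.Icc t₁ t₂ ∧ ‖ξ l s - ξ k s‖ ≤ c₀ * s / 4} with hSPR
  have hdc : Continuous fun s ↦ ‖ξ l s - ξ k s‖ := ((hξ l).continuous.sub (hξ k).continuous).norm
  have hSPRclosed : IsClosed SPR := by
    have : SPR = Set.Icc t₁ t₂ ∩ {s | ‖ξ l s - ξ k s‖ ≤ c₀ * s / 4} := by ext s; simp [hSPR]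
    rw [this]
    exact isClosed_Icc.inter (isClosed_le hdc ((continuous_const.mul continuous_id).div_const _))
  obtain ⟨τ₁, hτ₁, hspread, hafter⟩ : ∃ τ₁ ∈ Set.Icc t₁ t₂,
      (∀ s ∈ Set.Icc t₁ τ₁, s < τ₁ → c₀ * s / 4 ≤ ‖ξ l s - ξ k s‖) ∧ (τ₁ = t₂ ∨ ‖ξ l τ₁ - ξ k τ₁‖ ≤ c₀ * τ₁ / 4) := by
    by_cases hne : SPR.Nonempty
    · have hbdd : BddBelow SPR := ⟨t₁, fun s hs ↦ hs.1.1⟩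
      have hmem : sInf SPR ∈ SPR := hSPRclosed.csInf_mem hne hbdd
      refine ⟨sInf SPR, hmem.1, fun s hs hlt ↦ ?_, Or.inr hmem.2⟩
      by_contra hcon; push Not at hcon
      have : sInf SPR ≤ s := csInf_le hbdd ⟨⟨hs.1, hlt.le.trans hmem.1.2⟩, hcon.le⟩
      linarith
    · refine ⟨t₂, ⟨h12, le_rfl⟩, fun s hs _ ↦ ?_, Or.inl rfl⟩
      by_contra hcon; push Not at hcon
      exact hne ⟨s, ⟨hs.1, hs.2⟩, hcon.le⟩
  -- spread bound on the CLOSED interval when it is nontrivial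
  have hspread' : t₁ < τ₁ → ∀ s ∈ Set.Icc t₁ τ₁, c₀ * s / 4 ≤ ‖ξ l s - ξ k s‖ := by
    intro hlt s hs
    rcases eq_or_lt_of_le hs.2 with h | h
    · rw [h]
      have hcw : ContinuousWithinAt (fun s ↦ ‖ξ l s - ξ k s‖ - c₀ * s / 4) (Set.Ico t₁ τ₁) τ₁ :=
        (hdc.sub ((continuous_const.mul continuous_id).div_const _)).continuousAt.continuousWithinAt
      haveI : (𝓝[Set.Ico t₁ τ₁] τ₁).NeBot := by
        apply mem_closure_iff_nhdsWithin_neBot.mp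
        rw [closure_Ico hlt.ne]; exact ⟨hlt.le, le_rfl⟩
      have hev : ∀ᶠ y in 𝓝[Set.Ico t₁ τ₁] τ₁, 0 ≤ ‖ξ l y - ξ k y‖ - c₀ * y / 4 :=
        eventually_nhdsWithin_of_forall fun y hy ↦ by linarith [hspread y ⟨hy.1, hy.2.le⟩ hy.2]
      have := ge_of_tendsto hcw hev
      linarith
    · exact hspread s hs h
  -- the two singleton windows on `[t₁, τ₁]`
  have hphase1 : |E τ₁ - E t₁| ≤ 2 * Xs ∧ ∀ kk, |Pk kk τ₁ - Pk kk t₁| ≤ 2 * Xs := by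
    rcases eq_or_lt_of_le hτ₁.1 with heq | hlt
    · rw [← heq]; simp only [sub_self, abs_zero]
      exact ⟨by linarith, fun _ ↦ by linarith⟩
    have hsub : ∀ s ∈ Set.Icc t₁ τ₁, s ∈ Set.Icc t₁ t₂ := fun s hs ↦ ⟨hs.1, hs.2.trans hτ₁.2⟩
    -- generic singleton call: reference `i`, partner `j`
    have single : ∀ i j : Fin N, i ≠ j → ({i, j} : Finset (Fin N)) = {k, l} →
        (∀ s ∈ Set.Icc t₁ τ₁, c₀ * s / 4 ≤ ‖ξ j s - ξ i s‖) →
        |M i * (√(1 - ‖v i τ₁‖ ^ 2))⁻¹ - M i * (√(1 - ‖v i t₁‖ ^ 2))⁻¹| ≤ Xs ∧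
        ∀ kk : Fin 3, |M i * (√(1 - ‖v i τ₁‖ ^ 2))⁻¹ * v i τ₁ kk - M i * (√(1 - ‖v i t₁‖ ^ 2))⁻¹ * v i t₁ kk| ≤ Xs := by
      intro i j hij hpair hfarj
      have himem : i ∈ ({k, l} : Finset (Fin N)) := hpair ▸ (by simp)
      have hSc : (Finset.univ \ ({i} : Finset (Fin N))).Nonempty := ⟨j, by simp [hij.symm]⟩
      have hBF : ∀ m ∈ Finset.univ \ ({i} : Finset (Fin N)), m ∈ O ∨ m ∈ ({j} : Finset (Fin N)) := by
        intro m hm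
        have hmi : m ≠ i := by simpa using hm
        by_cases hmj : m = j
        · right; simp [hmj]
        · left
          rw [hOdef, ← hpair]
          simp [hmi, hmj]
      have hinf : ∀ s ∈ Set.Icc t₁ τ₁, 3 * ρ s ≤ (Finset.univ \ ({i} : Finset (Fin N))).inf' hSc fun m ↦ ‖ξ m s - ξ i s‖ :=
        fun s hs ↦ Finset.le_inf' _ _ fun m hm ↦ by
          have := (hρ s (hsub s hs)).1 m i (by simpa using hm); linarith
      have hρ' : ∀ s ∈ Set.Icc t₁ τ₁, ρ s ≤ min (c₀ * s)
          (2 / 3 * (Finset.univ \ ({i} : Finset (Fin N))).inf' hSc fun m ↦ ‖ξ m s - ξ i s‖) / 2 := by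
        intro s hs
        have h2 : ρ s ≤ c₀ * s / 2 := (hρ s (hsub s hs)).2
        have h3 := hinf s hs
        rw [le_div_iff₀ (by norm_num : (0 : ℝ) < 2), le_min_iff]
        constructor <;> linarith
      have htight : ∀ s ∈ Set.Icc t₁ τ₁, ∀ m ∈ ({i} : Finset (Fin N)), ‖ξ m s - ξ i s‖ ≤ min (c₀ * s)
          (2 / 3 * (Finset.univ \ ({i} : Finset (Fin N))).inf' hSc fun m ↦ ‖ξ m s - ξ i s‖) / 2 := by
        intro s hs m hm
        have : m = i := by simpa using hm
        subst this
        simp only [sub_self, norm_zero]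
        have hpos : 0 ≤ (Finset.univ \ ({m} : Finset (Fin N))).inf' hSc fun m' ↦ ‖ξ m' s - ξ m s‖ :=
          Finset.le_inf' _ _ fun m' _ ↦ norm_nonneg _
        have hcs : 0 ≤ c₀ * s := mul_nonneg hc₀.le (ht₁.le.trans hs.1)
        rw [le_div_iff₀ (by norm_num : (0 : ℝ) < 2), le_min_iff]
        constructor <;> linarith
      have h := tight_increment_mixed M ξ v κ P ρ C T T' T₀ ζ hWL hID hC hκ0 hκ1 hξ hspeed1
        (S := {i}) (B := O) (F := {j}) (a := i) hSc hBF hT hT' hT₀ ht₁ hτ₁.1 hW hA₀ (by positivity : (0 : ℝ) < c₀ / 4)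
        (fun s hs ↦ hcone i s (hsub s hs)) (n i) (fun m hm ↦ hn i himem m hm)
        (fun m hm s hs ↦ hball i himem m hm s (hsub s hs))
        (fun m hm s hs ↦ by
          have hmi : m ≠ i := fun h ↦ (Finset.mem_sdiff.mp (hOdef ▸ hm)).2 (h ▸ himem)
          have := hfar i m hmi.symm s (hsub s hs); rwa [norm_sub_rev] at this)
        (fun m hm s hs ↦ by
          have : m = j := by simpa using hm
          subst this
          have := hfarj s hs; linarith)
        hρ' htight
      have hb : C * (2 * (((κ - κ ^ 2) / 2) ^ (3 / 2 : ℝ))⁻¹ * (t₁ ^ (1 / 2 : ℝ))⁻¹ +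
          O.card * (2 * (2 * √2 * (8 / (W * √A₀)))) +
          ({j} : Finset (Fin N)).card * (2 * (2 * ((c₀ / 4) ^ (3 / 2 : ℝ))⁻¹ * (t₁ ^ (1 / 2 : ℝ))⁻¹))) + ζ t₁ + ζ τ₁ ≤ Xs := by
        rw [hXs, ← hc₀def, Finset.card_singleton, Nat.cast_one]
        linarith [hζ t₁ ⟨le_rfl, h12⟩, hζ τ₁ hτ₁]
      simp only [Finset.sum_singleton] at h
      exact ⟨h.1.trans hb, fun kk ↦ (h.2 kk).trans hb⟩
    have hk1 := single k l hkl rfl (hspread' hlt)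
    have hl1 := single l k hkl.symm (Finset.pair_comm l k) (fun s hs ↦ by rw [norm_sub_rev]; exact hspread' hlt s hs)
    refine ⟨?_, fun kk ↦ ?_⟩
    · simp only [hE, Finset.sum_pair hkl]
      calc |M k * (√(1 - ‖v k τ₁‖ ^ 2))⁻¹ + M l * (√(1 - ‖v l τ₁‖ ^ 2))⁻¹ -
            (M k * (√(1 - ‖v k t₁‖ ^ 2))⁻¹ + M l * (√(1 - ‖v l t₁‖ ^ 2))⁻¹)|
          = |(M k * (√(1 - ‖v k τ₁‖ ^ 2))⁻¹ - M k * (√(1 - ‖v k t₁‖ ^ 2))⁻¹) +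
            (M l * (√(1 - ‖v l τ₁‖ ^ 2))⁻¹ - M l * (√(1 - ‖v l t₁‖ ^ 2))⁻¹)| := by ring_nf
        _ ≤ _ := abs_add_le _ _
        _ ≤ 2 * Xs := by linarith [hk1.1, hl1.1]
    · simp only [hPk, Finset.sum_pair hkl]
      calc |M k * (√(1 - ‖v k τ₁‖ ^ 2))⁻¹ * v k τ₁ kk + M l * (√(1 - ‖v l τ₁‖ ^ 2))⁻¹ * v l τ₁ kk -
            (M k * (√(1 - ‖v k t₁‖ ^ 2))⁻¹ * v k t₁ kk + M l * (√(1 - ‖v l t₁‖ ^ 2))⁻¹ * v l t₁ kk)|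
          = |(M k * (√(1 - ‖v k τ₁‖ ^ 2))⁻¹ * v k τ₁ kk - M k * (√(1 - ‖v k t₁‖ ^ 2))⁻¹ * v k t₁ kk) +
            (M l * (√(1 - ‖v l τ₁‖ ^ 2))⁻¹ * v l τ₁ kk - M l * (√(1 - ‖v l t₁‖ ^ 2))⁻¹ * v l t₁ kk)| := by ring_nf
        _ ≤ _ := abs_add_le _ _
        _ ≤ 2 * Xs := by linarith [hk1.2 kk, hl1.2 kk]
  ---------------------------------------------------------------- the compact phase `[τ₁, t₂]`
  have hphase2 : |E t₂ - E τ₁| ≤ (O.card + 1) * Y ∧ ∀ kk, |Pk kk t₂ - Pk kk τ₁| ≤ (O.card + 1) * Y := by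
    rcases hafter with heq | hcompact
    · rw [heq]; simp only [sub_self, abs_zero]
      have : 0 ≤ ((O.card : ℝ) + 1) * Y := by positivity
      exact ⟨this, fun _ ↦ this⟩
    have hτ₁0 : 0 < τ₁ := ht₁.trans_le hτ₁.1
    -- compactness for ever after `τ₁`
    have hβ : ∀ s ∈ Set.Icc τ₁ t₂, ‖ξ l s - ξ k s‖ ≤ (κ - κ ^ 2) / 2 * s / 2 := by
      intro s hs
      have h0 : ‖ξ l τ₁ - ξ k τ₁‖ < 1 / 2 * (c₀ * τ₁) := by
        have : 0 < c₀ * τ₁ := mul_pos hc₀ hτ₁0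
        linarith
      have hσe : σ ≤ c₀ * (1 / 2) := hσ3
      have h := dist_lt_level_of_lt (d := fun s ↦ ‖ξ l s - ξ k s‖) hσe
        (hslow τ₁ hτ₁ s ⟨hτ₁.1.trans hs.1, hs.2⟩ hs.1) hs.1 h0
      have h' : ‖ξ l s - ξ k s‖ < 1 / 2 * (c₀ * s) := h
      rw [← hc₀def]; linarith
    -- the rounds, restricted to `[τ₁, t₂]`
    have hsub : ∀ s ∈ Set.Icc τ₁ t₂, s ∈ Set.Icc t₁ t₂ := fun s hs ↦ ⟨hτ₁.1.trans hs.1, hs.2⟩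
    set FU : ℝ → Finset (Fin N) := fun s ↦ O.filter fun m ↦ ⟪ξ m s - ξ k s, n k m⟫ - 3 * ‖ξ l s - ξ k s‖ < 0 with hFU
    have hround : ∀ u ∈ Set.Icc τ₁ t₂, ∃ τ' ∈ Set.Icc u t₂, (|E τ' - E u| ≤ Y ∧ ∀ kk, |Pk kk τ' - Pk kk u| ≤ Y) ∧
        (τ' = t₂ ∨ (FU τ').card + 1 ≤ (FU u).card) := by
      intro u hu
      obtain ⟨τ', hτ', hb, hend⟩ := pair_round M ξ v κ P ρ C T T' T₀ ζ hWL hID hC hκ0 hκ1 hξ hspeed1 hkl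
        (a := τ₁) (b := t₂) (hT.trans hτ₁.1) (hT'.trans hτ₁.1) (hT₀.trans hτ₁.1) hτ₁0 hW hA₀ hσ0 hσ1 hσ2
        (fun i s hs ↦ hcone i s (hsub s hs)) n hn (fun i hi m hm s hs ↦ hball i hi m hm s (hsub s hs))
        (fun i j hij s hs ↦ hfar i j hij s (hsub s hs))
        (fun s hs s' hs' hss' ↦ hslow s (hsub s hs) s' (hsub s' hs') hss') hβ
        (fun s hs ↦ hρ s (hsub s hs)) (fun s hs ↦ hζ s (hsub s hs)) (fun s hs ↦ hζ0 s (hsub s hs)) hu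
      -- `3 X(τ₁) ≤ Y`
      have hrp : (τ₁ ^ (1 / 2 : ℝ))⁻¹ ≤ (t₁ ^ (1 / 2 : ℝ))⁻¹ :=
        inv_anti₀ (Real.rpow_pos_of_pos ht₁ _) (Real.rpow_le_rpow ht₁.le hτ₁.1 (by norm_num))
      have hXY : 3 * (C * (2 * (((κ - κ ^ 2) / 2) ^ (3 / 2 : ℝ))⁻¹ * (τ₁ ^ (1 / 2 : ℝ))⁻¹ +
          (Finset.univ \ ({k, l} : Finset (Fin N))).card * (2 * (2 * √2 * (8 / (W * √A₀)))) +
          2 * (19 * (Finset.univ \ ({k, l} : Finset (Fin N))).card / (W * √A₀))) + 2 * ζstar) ≤ Y := by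
        rw [hY, ← hc₀def, ← hOdef]
        have hc32 : 0 ≤ (c₀ ^ (3 / 2 : ℝ))⁻¹ := inv_nonneg.mpr (Real.rpow_nonneg hc₀.le _)
        have h1 : C * (2 * (c₀ ^ (3 / 2 : ℝ))⁻¹ * (τ₁ ^ (1 / 2 : ℝ))⁻¹) ≤ C * (2 * (c₀ ^ (3 / 2 : ℝ))⁻¹ * (t₁ ^ (1 / 2 : ℝ))⁻¹) :=
          mul_le_mul_of_nonneg_left (mul_le_mul_of_nonneg_left hrp (by positivity)) hC
        nlinarith [h1]
      refine ⟨τ', hτ', ⟨?_, fun kk ↦ ?_⟩, ?_⟩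
      · have := hb.1; simp only [hE]; exact this.trans hXY
      · have := hb.2 kk; simp only [hPk]; exact this.trans hXY
      · simpa only [hFU] using hend
    -- fuel induction
    have claim : ∀ f : ℕ, ∀ u ∈ Set.Icc τ₁ t₂, (FU u).card ≤ f →
        |E t₂ - E u| ≤ (f + 1) * Y ∧ ∀ kk, |Pk kk t₂ - Pk kk u| ≤ (f + 1) * Y := by
      intro f
      induction f with
      | zero =>
        intro u hu hfuel
        obtain ⟨τ', hτ', hb, hend⟩ := hround u hu
        rcases hend with h | h
        · subst h; simp only [Nat.cast_zero, zero_add, one_mul]; exact hb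
        · omega
      | succ f IH =>
        intro u hu hfuel
        obtain ⟨τ', hτ', hb, hend⟩ := hround u hu
        rcases hend with h | h
        · subst h
          have h1 : Y ≤ ((f + 1 : ℕ) + 1 : ℝ) * Y := by
            have : (0 : ℝ) ≤ ((f + 1 : ℕ) : ℝ) := Nat.cast_nonneg _
            nlinarith
          exact ⟨hb.1.trans h1, fun kk ↦ (hb.2 kk).trans h1⟩
        · have hfuel' : (FU τ').card ≤ f := by omega
          have ih := IH τ' ⟨hu.1.trans hτ'.1, hτ'.2⟩ hfuel'
          refine ⟨?_, fun kk ↦ ?_⟩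
          · calc |E t₂ - E u| = |(E t₂ - E τ') + (E τ' - E u)| := by ring_nf
              _ ≤ |E t₂ - E τ'| + |E τ' - E u| := abs_add_le _ _
              _ ≤ (f + 1) * Y + Y := add_le_add ih.1 hb.1
              _ = ((f + 1 : ℕ) + 1 : ℝ) * Y := by push_cast; ring
          · calc |Pk kk t₂ - Pk kk u| = |(Pk kk t₂ - Pk kk τ') + (Pk kk τ' - Pk kk u)| := by ring_nf
              _ ≤ |Pk kk t₂ - Pk kk τ'| + |Pk kk τ' - Pk kk u| := abs_add_le _ _
              _ ≤ (f + 1) * Y + Y := add_le_add (ih.2 kk) (hb.2 kk)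
              _ = ((f + 1 : ℕ) + 1 : ℝ) * Y := by push_cast; ring
    have hfuel0 : (FU τ₁).card ≤ O.card := Finset.card_filter_le _ _
    have h := claim O.card τ₁ ⟨le_rfl, hτ₁.2⟩ hfuel0
    exact h
  ---------------------------------------------------------------- combine
  have hfinE : |E t₂ - E t₁| ≤ 2 * Xs + (O.card + 1) * Y := by
    calc |E t₂ - E t₁| = |(E t₂ - E τ₁) + (E τ₁ - E t₁)| := by ring_nf
      _ ≤ |E t₂ - E τ₁| + |E τ₁ - E t₁| := abs_add_le _ _
      _ ≤ (O.card + 1) * Y + 2 * Xs := add_le_add hphase2.1 hphase1.1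
      _ = 2 * Xs + (O.card + 1) * Y := by ring
  have hfinP : ∀ kk, |Pk kk t₂ - Pk kk t₁| ≤ 2 * Xs + (O.card + 1) * Y := fun kk ↦ by
    calc |Pk kk t₂ - Pk kk t₁| = |(Pk kk t₂ - Pk kk τ₁) + (Pk kk τ₁ - Pk kk t₁)| := by ring_nf
      _ ≤ |Pk kk t₂ - Pk kk τ₁| + |Pk kk τ₁ - Pk kk t₁| := abs_add_le _ _
      _ ≤ (O.card + 1) * Y + 2 * Xs := add_le_add (hphase2.2 kk) (hphase1.2 kk)
      _ = 2 * Xs + (O.card + 1) * Y := by ring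
  refine ⟨?_, fun kk ↦ ?_⟩
  · simpa only [hE, hXs, hY, hc₀def, hOdef] using hfinE
  · simpa only [hPk, hXs, hY, hc₀def, hOdef] using hfinP kk

/-- Registered helper form: the unordered pair is symmetric (carrier of this file). [folklore] -/
theorem oracle_pair_comm : ∀ (N : ℕ) (k l : Fin N), ({l, k} : Finset (Fin N)) = {k, l} :=
  fun _ k l ↦ Finset.pair_comm l k

end Summit.FinalStateConjecture.FinalStateConjecture.Theorems.SublinearIsFree.Oracle

end
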